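import Summits.QuantumFields.YangMills.Theorems.BalabanUVNodesN15KingModelFullPropagatorRiemann
import Summits.QuantumFields.YangMills.Theorems.BalabanUVNodesN15KingModelPotentialDressedMinimiser
import Summits.QuantumFields.YangMills.Theorems.BalabanUVNodesN15KingModelPotentialNE2

/-!
# BalabanUVNodes ∕ N15 — THE KING MODEL, PART 10c: THE (3.36)∕(H3) TWO-SPACING RATE OF THE FULL PERTURBATION `Δ^{(k)}_v − Δ^{(k)}`,
# DERIVED — `EffectiveOperatorSupRate (fullPert v) (c·(w₀ + ν₀)) (L^{−1∕2})` for every coherent potential tower in a uniform window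
# (Track A, DAG node N15 = NE2; FAN-OUT v1.1 §N15 s3 «KING-MODEL RUNG»)

HONEST FRAMING.  Count-neutral kernel bookkeeping (cell `pub-ymgap`, seat `pub-ymgap-dag-n15-d` g8; `--supports stmt-QuantumFields-20292
--as helper` = K3⁗ `SpineGivenEndpointR13Sep`; lineage K3 19676 → K3′ 19908 → K3‴ 19912).  King's `A = 0` SCALAR block-spin tower
([King1986] §2.2 (2.13)–(2.15) p. 653, §4 (4.5) p. 670, Lemma 4.3 (4.18) p. 672) on the King-admissible unit tori `Π ℤ∕(2L^{e+1})`
(odd `L ≥ 3`, `m² > 0`) dressed NONPERTURBATIVELY by a fine-lattice POTENTIAL TOWER `v = (v_N)_N` (part 9c's `kingTowerPot` ∕ `fullPert`); the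
potential is a multiplication operator, NOT a gauge field; nothing here is Bałaban's `Δ^{(k)}(U) − Δ^{(k)}(1)` ∕ `C^{(k)}(Λ; U)`; NOT a node
discharge; nothing continuum ∕ ℝ⁴ ∕ OS ∕ mass-gap ∕ Clay.  0 `sorry`, 0 `def`, standard axioms.

THE POINT.  Part 9d's background sort `potBgW` READ the η-rate letter (3.36) of the full perturbation `E_j(v) = Δ^{(max j 1)}_v − Δ^{(max j 1)}`
as a hypothesis (`EffectiveOperatorSupRate (fullPert v) (c₃₅α₀) r`); parts 8a∕8b had proved it for the FIRST VARIATION `δΔ^{(k)}[v]` only.  THIS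
FILE PROVES IT for the full dressing: ★★ **`fullPert_supRate_kingU`** — there are `w̄₁₀, c > 0` (functions of `d, L, a, m²`) such that for every
volume exponent `e`, every potential tower `v` on the fine tori over `Π ℤ∕(2L^{e+1})` of size `sup_{N,x}|v_N(x)| ≤ w₀ ≤ w̄₁₀` and every coherence
letter `sup_{x′}|v_{L·L^k}(x′) − v_{L^k}(x)| ≤ ν₀·s^k` (`k ≥ 1`, `x` under `x′`, `0 ≤ s ≤ L^{−1∕2}`):
`EffectiveOperatorSupRate (fullPert a m² L (kingM d L e) v) (c·(w₀ + ν₀)) (L^{−1∕2})`, i.e. `sup_{b,b′}|E_{k+1}(v)(b, b′) − E_k(v)(b, b′)| ≤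
c·(w₀ + ν₀)·(L^{−1∕2})^k` at every `k` — part 8c's coherence sort `potBg` now carries the FULLY dressed tower (part 10d fires the socket).
MECHANISM (parts 10a∕10b BY NAME): `E_k(v)(b, b′) = N^{−(d+1)}Σ_x ℋ_k(x, b)v(x)ℋ_{k,v}(x, b′)` exactly (`effLaplacianPot_sub_apply`); the dressed
minimiser `ℋ_{k,v}` is bounded (`kingHPot_abs_le`) and two-spacing-close to `ℋ_{k+1,v′}` (`kingHPot_step_le`) in the ℓ^∞ window
`C_M·w₀ ≤ 1∕2`, `C_M` the uniform Riemann mass of King's fluctuation propagator (`fullProp_riemannMass_unif`), with the Riemann-sum two-spacing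
rate `fullProp_riemannRate_unif` (γ = 1) of part 10a, King's printed minimiser letters (Theorem 3.3 decay `kingH_decay_kingU`, Prop. 3.8 step
`kingH_step_kingU`, part 8b) and the coherence defect of the potentials; invertibility of `A₀ + diag v` in the window `w₀ ≤ w̄ = γ_A(a_min)∕4`
(parts 9a∕9c `fineOpPot_isUnit`, `gap_unif`); then `effLaplacianPot_sub_step_le` and one bookkeeping inequality (`rate_bookkeeping`).
* §1 `fullPert_of_one_le`, `kingLevelPot_sub_congr` (the level-`(k+1)` entry read at the fine count `L·L^k`), `rate_bookkeeping`;
* §2 ★★ `fullPert_supRate_kingU`.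
HONEST SCOPE.  (i) King-admissible tori `2L^{e+1} = fine L (2L^e)` only (the Riemann bounds of part 10a live on Bałaban's cubes); (ii) rate
`L^{−1∕2}` (Prop. 3.8 at `γ = 1` as in part 8b; immaterial for the shape); (iii) the window `w̄₁₀ = min(w̄, 1∕(2C_M))` is uniform in `k`, the
volume and the potential but depends on `m²` through `C_M`; (iv) scalar potential, `A = 0`; not Bałaban's (3.36); not a discharge.
Locators: [King1986] C. King, CMP **102** (1986) 649–677: (2.13)–(2.15) p. 653, Theorem 3.3 (3.7) p. 658 (PDF: p. 655, (3.7) p. 656), Prop. 3.8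
(3.71) p. 664 and p. 664 (pairing), Lemma 4.3 (4.18) p. 672, (4.39)–(4.41) p. 675; [B9] = [Balaban1985BackgroundPropagators] (3.35)–(3.36)
p. 396 (the two regularity slots: typing template).
-/

noncomputable section

open scoped BigOperators Matrix
open Finset

namespace Summit.QuantumFields.YangMills.BalabanUVNodes.N15.KingModel

open Literature.MathematicalPhysics.QuantumFieldTheory.Balaban1983to89 hiding blockOf
open Literature.MathematicalPhysics.QuantumFieldTheory.Balaban1983to89.B4Sect5Proof (latticeConst latticeConst_nonneg)
open Literature.MathematicalPhysics.QuantumFieldTheory.Balaban1983to89.B5Prop11Plancherel (Tor fine)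
open Literature.MathematicalPhysics.QuantumFieldTheory.King1986 (aK aK_pos)
open Literature.MathematicalPhysics.QuantumFieldTheory.King1986.Torus
open Summit.QuantumFields.BalabanUV.T4Continuum.NE2KingTransplant (EffectiveOperatorSupRate)
open Summit.QuantumFields.YangMills.BalabanUVNodes.N15KingModelRung (kingH)
open Summit.QuantumFields.YangMills.BalabanUVNodes.N15KingModelRung.Curved (underPtN val_underPtN blockOf_underPtN)

variable {d : ℕ}

/-! ## §1 Reading the full perturbation at level `k ≥ 1` and at the fine count `L·L^k`; the bookkeeping inequality -/

section Congr

variable {a m2 : ℝ} {L : ℕ} [NeZero L] {M : Fin (d + 1) → ℕ} [∀ μ, NeZero (M μ)]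

/-- From level 1 on, `E_j(v) = Δ^{(j)}_{v_{L^j}} − Δ^{(j)}`. [folklore] -/
theorem fullPert_of_one_le (v : ∀ N : ℕ, Tor (fine N (fine L M)) → ℝ) {j : ℕ} (hj : 1 ≤ j) :
    fullPert a m2 L M v j = kingLevelPot a m2 L M j (v (L ^ j)) - kingLevelPot a m2 L M j 0 := by
  have h : ∀ n : ℕ, n = j → kingLevelPot a m2 L M n (v (L ^ n)) - kingLevelPot a m2 L M n 0
      = kingLevelPot a m2 L M j (v (L ^ j)) - kingLevelPot a m2 L M j 0 := by
    rintro n rfl; rfl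
  rw [fullPert_apply]
  exact h _ (max_eq_left hj)

/-- The dressed effective Laplacian at the zero potential (spelled `0`) is King's. [folklore] -/
theorem effLaplacianPot_zero'' {N : ℕ} [NeZero N] {U : Fin (d + 1) → ℕ} [∀ μ, NeZero (U μ)] (c : ℝ) :
    effLaplacianPot N U a c m2 0 = effLaplacian N U a c m2 :=
  effLaplacianPot_zero

/-- **Reading the level-`k` perturbation at any spelling of the fine count**: for `N′ = L^k` (e.g. `N′ = L·L^{k−1}`),
`Δ^{(k)}_{v_{L^k}} − Δ^{(k)} = Δ_eff,N′(v_{N′}) − Δ_eff,N′` (the potential tower is read at the same count under both spellings). [folklore] -/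
theorem kingLevelPot_sub_congr (v : ∀ N : ℕ, Tor (fine N (fine L M)) → ℝ) {k : ℕ} {N' : ℕ} [NeZero N'] (h : L ^ k = N') :
    kingLevelPot a m2 L M k (v (L ^ k)) - kingLevelPot a m2 L M k 0
      = effLaplacianPot N' (fine L M) (aK a L k) (((N' : ℕ) : ℝ) ^ 2) m2 (v N')
        - effLaplacian N' (fine L M) (aK a L k) (((N' : ℕ) : ℝ) ^ 2) m2 := by
  subst h
  unfold kingLevelPot
  rw [effLaplacianPot_zero'']

omit [NeZero L] [∀ μ, NeZero (M μ)] in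
/-- THE BOOKKEEPING INEQUALITY of §2: the five terms of part 10b's bound, each at most its coefficient times `(w₀ + ν₀)·t` (`w₀ ≤ w̄`, `s ≤ t`).
[folklore] -/
theorem rate_bookkeeping {K cH CS CR CM wb w₀ ν₀ s t : ℝ} (hK : 0 ≤ K) (hcH : 0 ≤ cH) (hCS : 0 ≤ CS) (hCR : 0 ≤ CR) (hCM : 0 ≤ CM)
    (hw₀ : 0 ≤ w₀) (hν₀ : 0 ≤ ν₀) (hs : 0 ≤ s) (hwb : w₀ ≤ wb) (hst : s ≤ t) :
    K * (CS * t * (w₀ * (2 * cH)) + cH * (ν₀ * s * (2 * cH) + w₀ * (2 * (CS * t + CR * t * (w₀ * (2 * cH)) + CM * (ν₀ * s * (2 * cH))))))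
      ≤ K * (4 * cH * CS + 2 * cH ^ 2 + 4 * cH ^ 2 * CR * wb + 4 * cH ^ 2 * CM * wb) * (w₀ + ν₀) * t := by
  have ht : 0 ≤ t := hs.trans hst
  have hW₁ : w₀ ≤ w₀ + ν₀ := by linarith
  have hW₂ : ν₀ ≤ w₀ + ν₀ := by linarith
  have h1 : CS * t * (w₀ * (2 * cH)) ≤ CS * t * ((w₀ + ν₀) * (2 * cH)) := by gcongr
  have h2 : cH * (ν₀ * s * (2 * cH)) ≤ cH * ((w₀ + ν₀) * t * (2 * cH)) := by gcongr
  have h3 : cH * (w₀ * (2 * (CS * t))) ≤ cH * ((w₀ + ν₀) * (2 * (CS * t))) := by gcongr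
  have hwb0 : 0 ≤ wb := hw₀.trans hwb
  have h4 : cH * (w₀ * (2 * (CR * t * (w₀ * (2 * cH))))) ≤ cH * ((w₀ + ν₀) * (2 * (CR * t * (wb * (2 * cH))))) := by gcongr
  have h5 : cH * (w₀ * (2 * (CM * (ν₀ * s * (2 * cH))))) ≤ cH * (wb * (2 * (CM * ((w₀ + ν₀) * t * (2 * cH))))) := by gcongr
  have e1 : CS * t * (w₀ * (2 * cH)) + cH * (ν₀ * s * (2 * cH) + w₀ * (2 * (CS * t + CR * t * (w₀ * (2 * cH)) + CM * (ν₀ * s * (2 * cH)))))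
      = CS * t * (w₀ * (2 * cH)) + cH * (ν₀ * s * (2 * cH)) + cH * (w₀ * (2 * (CS * t)))
        + cH * (w₀ * (2 * (CR * t * (w₀ * (2 * cH))))) + cH * (w₀ * (2 * (CM * (ν₀ * s * (2 * cH))))) := by ring
  have e2 : (4 * cH * CS + 2 * cH ^ 2 + 4 * cH ^ 2 * CR * wb + 4 * cH ^ 2 * CM * wb) * (w₀ + ν₀) * t
      = CS * t * ((w₀ + ν₀) * (2 * cH)) + cH * ((w₀ + ν₀) * t * (2 * cH)) + cH * ((w₀ + ν₀) * (2 * (CS * t)))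
        + cH * ((w₀ + ν₀) * (2 * (CR * t * (wb * (2 * cH))))) + cH * (wb * (2 * (CM * ((w₀ + ν₀) * t * (2 * cH))))) := by ring
  rw [e1, mul_assoc K, mul_assoc K, e2]
  exact mul_le_mul_of_nonneg_left (by linarith) hK

end Congr

/-! ## §2 The (3.36)∕(H3) rate of the full perturbation, derived -/

section Rate

open Real

variable (L : ℕ) [NeZero L]

/-- **THE TWO-SPACING η-RATE OF THE FULL PERTURBATION `Δ^{(k)}_v − Δ^{(k)}`, DERIVED** (the (3.36)∕(H3) letter part 9d READ).  For odd `L ≥ 3`,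
`a, m² > 0` and dimension `d + 1` there are `w̄₁₀, c > 0` such that for every volume exponent `e`, every potential tower `v` on the fine tori over
the King-admissible unit torus `Π ℤ∕(2L^{e+1})` with `sup_{N,x}|v_N(x)| ≤ w₀ ≤ w̄₁₀`, and every coherence letter `|v_{L·L^k}(x′) − v_{L^k}(x)| ≤ ν₀·s^k`
(`k ≥ 1`, `x` under `x′`, `0 ≤ ν₀`, `0 ≤ s ≤ L^{−1∕2}`):  `EffectiveOperatorSupRate (fullPert a m² L (kingM d L e) v) (c·(w₀ + ν₀)) (L^{−1∕2})`.
Mechanism: module docstring (parts 10a∕10b + King's printed minimiser letters of part 8b + the window of parts 9a∕9c).  HONEST SCOPE: King's `A = 0`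
scalar tower, scalar potential, NOT Bałaban's (3.36); not a discharge. [cite: King1986, (2.13)–(2.15) p.653, Theorem 3.3 (3.7) p.658, Prop. 3.8 (3.71) p.664, Lemma 4.3 (4.18) p.672, (4.39)–(4.41) p.675; Balaban1985BackgroundPropagators, (3.36) p.396 (slot)] -/
theorem fullPert_supRate_kingU (hLodd : Odd L) (hL : 2 ≤ L) {a m2 : ℝ} (ha : 0 < a) (hm : 0 < m2) :
    ∃ wb c : ℝ, 0 < wb ∧ 0 < c ∧ ∀ (e : ℕ) (v : ∀ N : ℕ, Tor (fine N (kingU d L e)) → ℝ) (w₀ ν₀ s : ℝ),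
      (∀ (N : ℕ) (x : Tor (fine N (kingU d L e))), |v N x| ≤ w₀) → w₀ ≤ wb → 0 ≤ ν₀ → 0 ≤ s → s ≤ (L : ℝ) ^ (-(1 / 2 : ℝ)) →
      (∀ (k : ℕ), 1 ≤ k → ∀ x' : Tor (fine (L ^ 1 * L ^ k) (kingU d L e)),
          |v (L ^ 1 * L ^ k) x' - v (L ^ k) (underPtN L k 1 (kingU d L e) x')| ≤ ν₀ * s ^ k) →
      EffectiveOperatorSupRate (fullPert a m2 L (kingM d L e) v) (c * (w₀ + ν₀)) ((L : ℝ) ^ (-(1 / 2 : ℝ))) := by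
  have hL1 : 1 < L := by omega
  have hLr : (1 : ℝ) < L := by exact_mod_cast hL1
  -- the letters of the undressed minimiser (part 8b) and the Riemann bounds of the fluctuation propagator (part 10a)
  obtain ⟨δH, cH, hδH, hcH, HH⟩ := kingH_decay_kingU (d := d) L hLodd hL ha hm.le
  obtain ⟨δS, CS, hδS, hCS, HS⟩ := kingH_step_kingU (d := d) L hLodd hL ha hm
  obtain ⟨CM, hCM, HM⟩ := fullProp_riemannMass_unif (d := d) L hLodd hL ha hm.le
  obtain ⟨CR, hCR, HR⟩ := fullProp_riemannRate_unif (d := d) L hLodd hL ha hm.le (γ := 1) zero_le_one le_rfl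
  obtain ⟨-, -, hwbar⟩ := dressedConsts_nonneg (d := d) ha hL
  obtain ⟨hr0, hr1, -⟩ := rate_facts L hL
  -- the common decay rate of the two minimiser letters, and the constants of the theorem
  set δ : ℝ := min δH δS with hδdef
  have hδ : 0 < δ := lt_min hδH hδS
  set Kδ : ℝ := latticeConst (d + 1) δ with hKδ
  have hKδ0 : 0 ≤ Kδ := latticeConst_nonneg (d + 1) hδ.le
  set wb : ℝ := min (wbarK (d + 1) a L) (1 / (2 * CM)) with hwbdef
  have hwb : 0 < wb := lt_min hwbar (by positivity)
  set c : ℝ := Kδ * (4 * cH * CS + 2 * cH ^ 2 + 4 * cH ^ 2 * CR * wb + 4 * cH ^ 2 * CM * wb) + 1 with hcdef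
  have hc : 0 < c := by positivity
  refine ⟨wb, c, hwb, hc, fun e v w₀ ν₀ s hv hw hν₀ hs0 hs1 hcoh k z z' => ?_⟩
  set r : ℝ := (L : ℝ) ^ (-(1 / 2 : ℝ)) with hrdef
  have hw₀ : 0 ≤ w₀ := (abs_nonneg _).trans (hv 0 fun _ => 0)
  have hWt : 0 ≤ c * (w₀ + ν₀) * r ^ k := by positivity
  rcases Nat.eq_zero_or_pos k with hk0 | hk
  · -- `k = 0`: both levels are level 1
    subst hk0
    have key : ∀ n : ℕ, n = 1 → kingLevelPot a m2 L (kingM d L e) n (v (L ^ n)) - kingLevelPot a m2 L (kingM d L e) n 0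
        = kingLevelPot a m2 L (kingM d L e) 1 (v (L ^ 1)) - kingLevelPot a m2 L (kingM d L e) 1 0 := by
      rintro n rfl; rfl
    have h10 : fullPert a m2 L (kingM d L e) v (0 + 1) = fullPert a m2 L (kingM d L e) v 0 := by
      rw [fullPert_apply, fullPert_apply, key (max (0 + 1) 1) (by norm_num), key (max 0 1) (by norm_num)]
    rw [h10, sub_self, Matrix.zero_apply, abs_zero]
    exact hWt
  -- `k ≥ 1`: the two runs `L^k`, `L·L^k` over the unit torus `(kingU d L e) = Π ℤ∕(2L^{e+1})`
  have hk1 : 1 ≤ k := hk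
  have hM' : ∀ μ, kingU d L e μ = 2 * L ^ (e + 1) := fun μ => by
    show L * (2 * L ^ e) = 2 * L ^ (e + 1)
    ring
  have hN' : L ^ 1 * L ^ k = L ^ (k + 1) := by ring
  have hak : 0 < aK a L k := aK_pos ha hLr hk1
  have hak' : 0 < aK a L (k + 1) := aK_pos ha hLr (by omega)
  -- sizes and the window
  have hwbar' : w₀ ≤ wbarK (d + 1) a L := hw.trans (min_le_left _ _)
  have hwin : CM * w₀ ≤ 1 / 2 := by
    have h1 : w₀ ≤ 1 / (2 * CM) := hw.trans (min_le_right _ _)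
    rw [le_div_iff₀ (by positivity)] at h1
    linarith
  have hlo : ∀ (N : ℕ) (x : Tor (fine N (kingU d L e))), -w₀ ≤ v N x := fun N x => (abs_le.mp (hv N x)).1
  have hB : IsUnit (fineOpPot (L ^ k) (kingU d L e) (aK a L k) (((L ^ k : ℕ) : ℝ) ^ 2) m2 (v (L ^ k))) :=
    fineOpPot_isUnit hak.le hm.le (hlo (L ^ k)) (by
      obtain ⟨-, -, hgap, -⟩ := gap_unif (d := d) ha hL hk1 hwbar'
      have hP : 0 ≤ (2 * ((d + 1 : ℕ) : ℝ) + aK a L k) * (4 * kapCT (d + 1) a L) ^ 2 := by positivity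
      linarith)
  have hB' : IsUnit (fineOpPot (L ^ 1 * L ^ k) (kingU d L e) (aK a L (k + 1)) (((L ^ 1 * L ^ k : ℕ) : ℝ) ^ 2) m2 (v (L ^ 1 * L ^ k))) :=
    fineOpPot_isUnit hak'.le hm.le (hlo (L ^ 1 * L ^ k)) (by
      obtain ⟨-, -, hgap, -⟩ := gap_unif (d := d) ha hL (by omega : 1 ≤ k + 1) hwbar'
      have hP : 0 ≤ (2 * ((d + 1 : ℕ) : ℝ) + aK a L (k + 1)) * (4 * kapCT (d + 1) a L) ^ 2 := by positivity
      linarith)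
  -- the letters of the undressed minimiser at the common rate `δ`
  have ht0 := fun (x : Tor (fine (L ^ k) (kingU d L e))) (b : Tor (kingU d L e)) => (tdistT_isPseudoDist (kingU d L e)).nonneg (blockOf (L ^ k) (kingU d L e) x) b
  have hHdec : ∀ (b : Tor (kingU d L e)) (x : Tor (fine (L ^ k) (kingU d L e))),
      |kingH L (L ^ k) (kingU d L e) a m2 k b x| ≤ cH * Real.exp (-(δ * tdistT (kingU d L e) (blockOf (L ^ k) (kingU d L e) x) b)) :=
    fun b x => decay_mono hcH.le (min_le_left _ _) (ht0 x b) (HH e k hk1 (L ^ k) rfl b x)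
  have hstep : ∀ (b : Tor (kingU d L e)) (x' : Tor (fine (L ^ 1 * L ^ k) (kingU d L e))),
      |kingH L (L ^ 1 * L ^ k) (kingU d L e) a m2 (k + 1) b x' - kingH L (L ^ k) (kingU d L e) a m2 k b (underPtN L k 1 (kingU d L e) x')|
        ≤ CS * r ^ k * Real.exp (-(δ * tdistT (kingU d L e) (blockOf (L ^ 1 * L ^ k) (kingU d L e) x') b)) :=
    fun b x' => decay_mono (by positivity) (min_le_right _ _) ((tdistT_isPseudoDist (kingU d L e)).nonneg _ _) (HS e k hk1 b x')
  have hH0 : ∀ (b : Tor (kingU d L e)) (x : Tor (fine (L ^ k) (kingU d L e))), |kingH L (L ^ k) (kingU d L e) a m2 k b x| ≤ cH := fun b x =>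
    (hHdec b x).trans (mul_le_of_le_one_right hcH.le (Real.exp_le_one_iff.mpr (by
      exact neg_nonpos.mpr (mul_nonneg hδ.le (ht0 x b)))))
  have hH0' : ∀ (b : Tor (kingU d L e)) (x' : Tor (fine (L ^ 1 * L ^ k) (kingU d L e))), |kingH L (L ^ 1 * L ^ k) (kingU d L e) a m2 (k + 1) b x'| ≤ cH :=
    fun b x' => (HH e (k + 1) (by omega) (L ^ 1 * L ^ k) hN' b x').trans (mul_le_of_le_one_right hcH.le
      (Real.exp_le_one_iff.mpr (neg_nonpos.mpr (mul_nonneg hδH.le ((tdistT_isPseudoDist (kingU d L e)).nonneg _ _)))))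
  have hstep0 : ∀ (b : Tor (kingU d L e)) (x' : Tor (fine (L ^ 1 * L ^ k) (kingU d L e))),
      |kingH L (L ^ 1 * L ^ k) (kingU d L e) a m2 (k + 1) b x' - kingH L (L ^ k) (kingU d L e) a m2 k b (underPtN L k 1 (kingU d L e) x')| ≤ CS * r ^ k :=
    fun b x' => (hstep b x').trans (mul_le_of_le_one_right (by positivity) (Real.exp_le_one_iff.mpr (by
      exact neg_nonpos.mpr (mul_nonneg hδ.le ((tdistT_isPseudoDist (kingU d L e)).nonneg _ _)))))
  -- the Riemann bounds of part 10a at the two runs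
  have hmass : ∀ x : Tor (fine (L ^ k) (kingU d L e)), (((L ^ k : ℕ) : ℝ) ^ (d + 1))⁻¹ *
      ∑ y, |constrainedProp (L ^ k) (kingU d L e) (aK a L k) (((L ^ k : ℕ) : ℝ) ^ 2) m2 x y| ≤ CM :=
    fun x => HM k hk1 (L ^ k) rfl (e + 1) (kingU d L e) hM' m2 hm le_rfl x
  have hmass' : ∀ x' : Tor (fine (L ^ 1 * L ^ k) (kingU d L e)), (((L ^ 1 * L ^ k : ℕ) : ℝ) ^ (d + 1))⁻¹ *
      ∑ y', |constrainedProp (L ^ 1 * L ^ k) (kingU d L e) (aK a L (k + 1)) (((L ^ 1 * L ^ k : ℕ) : ℝ) ^ 2) m2 x' y'| ≤ CM :=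
    fun x' => HM (k + 1) (by omega) (L ^ 1 * L ^ k) hN' (e + 1) (kingU d L e) hM' m2 hm le_rfl x'
  have hrate : ∀ x' : Tor (fine (L ^ 1 * L ^ k) (kingU d L e)), (((L ^ 1 * L ^ k : ℕ) : ℝ) ^ (d + 1))⁻¹ *
      ∑ y', |constrainedProp (L ^ 1 * L ^ k) (kingU d L e) (aK a L (k + 1)) (((L ^ 1 * L ^ k : ℕ) : ℝ) ^ 2) m2 x' y'
        - constrainedProp (L ^ k) (kingU d L e) (aK a L k) (((L ^ k : ℕ) : ℝ) ^ 2) m2 (underPtN L k 1 (kingU d L e) x') (underPtN L k 1 (kingU d L e) y')|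
      ≤ CR * r ^ k := by
    intro x'
    exact HR k hk1 1 le_rfl (e + 1) (kingU d L e) hM' m2 hm le_rfl x'
  -- sizes of the two potentials and the coherence defect
  have hwk : ∀ y, |v (L ^ k) y| ≤ w₀ := hv (L ^ k)
  have hwk' : ∀ y', |v (L ^ 1 * L ^ k) y'| ≤ w₀ := hv (L ^ 1 * L ^ k)
  have hcohk := hcoh k hk1
  -- the dressed size (10b §2) and the dressed step (10b §3) at the finer run
  have hH' : ∀ (b : Tor (kingU d L e)) (y' : Tor (fine (L ^ 1 * L ^ k) (kingU d L e))),
      |kingHPot L (L ^ 1 * L ^ k) (kingU d L e) a m2 (k + 1) (v (L ^ 1 * L ^ k)) b y'| ≤ 2 * cH :=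
    fun b y' => kingHPot_abs_le hak'.le hm hB' hcH.le hH0' hmass' hwk' hwin b y'
  have hSd : ∀ (b : Tor (kingU d L e)) (y' : Tor (fine (L ^ 1 * L ^ k) (kingU d L e))),
      |kingHPot L (L ^ 1 * L ^ k) (kingU d L e) a m2 (k + 1) (v (L ^ 1 * L ^ k)) b y'
          - kingHPot L (L ^ k) (kingU d L e) a m2 k (v (L ^ k)) b (underPtN L k 1 (kingU d L e) y')|
        ≤ 2 * (CS * r ^ k + CR * r ^ k * (w₀ * (2 * cH)) + CM * (ν₀ * s ^ k * (2 * cH))) :=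
    fun b y' => kingHPot_step_le L hak.le hak'.le hm hB hB' (by positivity) hCM.le (by positivity) (by positivity)
      hstep0 hmass hrate hwk hwk' hcohk hwin hH' b y'
  -- the entry of the difference, read at the fine count `L·L^k`, and part 10b §4
  have hN'' : L ^ (k + 1) = L ^ 1 * L ^ k := hN'.symm
  rw [Matrix.sub_apply, fullPert_of_one_le v (by omega : 1 ≤ k + 1), fullPert_of_one_le v hk1,
    kingLevelPot_sub_congr v hN'', kingLevelPot_sub_congr v (rfl : L ^ k = L ^ k)]
  have hmain := effLaplacianPot_sub_step_le L hak.le hak'.le hm hB hB' hcH.le (by positivity : 0 ≤ CS * r ^ k) hδ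
    (by positivity : 0 ≤ 2 * cH) (by positivity) hHdec hstep hwk hwk' hcohk hH' hSd z z'
  refine hmain.trans ?_
  -- bookkeeping: every term carries `w₀` or `ν₀` and one factor `r^k` (`s^k ≤ r^k`)
  have hsr : s ^ k ≤ r ^ k := pow_le_pow_left₀ hs0 hs1 k
  have hbk := rate_bookkeeping (K := Kδ) (t := r ^ k) hKδ0 hcH.le hCS.le hCR.le hCM.le hw₀ hν₀ (pow_nonneg hs0 k) hw hsr
  calc latticeConst (d + 1) δ * (CS * r ^ k * (w₀ * (2 * cH))
          + cH * (ν₀ * s ^ k * (2 * cH) + w₀ * (2 * (CS * r ^ k + CR * r ^ k * (w₀ * (2 * cH)) + CM * (ν₀ * s ^ k * (2 * cH))))))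
      ≤ Kδ * (4 * cH * CS + 2 * cH ^ 2 + 4 * cH ^ 2 * CR * wb + 4 * cH ^ 2 * CM * wb) * (w₀ + ν₀) * r ^ k := hbk
    _ ≤ c * (w₀ + ν₀) * r ^ k := by
        have hWr : 0 ≤ (w₀ + ν₀) * r ^ k := by positivity
        have hle : Kδ * (4 * cH * CS + 2 * cH ^ 2 + 4 * cH ^ 2 * CR * wb + 4 * cH ^ 2 * CM * wb) ≤ c := by rw [hcdef]; linarith
        have h := mul_le_mul_of_nonneg_right hle hWr
        calc _ = Kδ * (4 * cH * CS + 2 * cH ^ 2 + 4 * cH ^ 2 * CR * wb + 4 * cH ^ 2 * CM * wb) * ((w₀ + ν₀) * r ^ k) := by ring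
          _ ≤ c * ((w₀ + ν₀) * r ^ k) := h
          _ = c * (w₀ + ν₀) * r ^ k := by ring

end Rate

end Summit.QuantumFields.YangMills.BalabanUVNodes.N15.KingModel

end
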